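import Literature.Geometry.Riemannian.LevelFamilyVariation
import Literature.Geometry.Riemannian.ExpMapEnergyTaylor
import Literature.Geometry.Lorentzian.LeviCivitaProofs
import HarnessLib

/-!
# Generalized cylinders `(N × ℝ, g_t + dt²)`: the `t`-lines are unit-speed geodesics normal to the
# slices, first variation `ġ_t = 2 K_t` and the Riccati identity for `K_t`
# (Bär–Gauduchon–Moroianu 2005, §§2–4; Bär–Hanke 2023, §3, (8)–(9))

Topic `Literature/Geometry/Riemannian`. A brick of the proof programme of
`Literature.Geometry.Riemannian.BaerHankePscGluing`. Bär–Hanke's formula (9) for the scalar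
curvature near the boundary is the formula of Bär–Gauduchon–Moroianu (Math. Z. 249 (2005),
Prop. 4.1) for a **generalized cylinder**: the product manifold `N × ℝ` with a metric of the form
`G = g_t + dt²` for a smooth one-parameter family `g_t` of metrics on `N`. In the tree's language
this is a `PseudoRiemannianMetric G` on `N × ℝ` (model `I'.prod 𝓘(ℝ, ℝ)`, tangent spaces
`T_zN × ℝ`) with the **cylinder property**

  `G_p((v, a), (w, b)) = G_p((v, 0), (w, 0)) + a b`        (`hcyl`),

and `g_t` is the metric induced on the slice `ι_t : y ↦ (y, t)`. This file proves:

* `velocity_cylLine`, `mfderiv_cylSlice_apply` — `∂_t` of the `t`-line `τ ↦ (y, τ)` is `(0, 1)`,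
  `dι_t(v) = (v, 0)`;
* `covariantDerivAlong_velocity_cylLine` — **the `t`-lines are geodesics**: `D_t ∂_t = 0`
  (BGM 2005, §2: `∇_{∂_t} ∂_t = 0`; O'Neill 1983, Ch. 7, Prop. 35 for warped products). Proof by
  nondegeneracy: `G(D_t∂_t, ∂_t) = ½ ∂_t G(∂_t, ∂_t) = 0` and, for the variation
  `x(t, s) = (c_u(s), t)` through a chart-straight curve `c_u` of `N`,
  `G(D_t∂_t, (u, 0)) = -G(∂_t, D_t ∂_s x) = -G(∂_t, D_s ∂_t x) = -½ ∂_s G(∂_t, ∂_t) = 0`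
  (metric compatibility along curves, symmetry lemma `D_t ∂_s = D_s ∂_t`);
* `hasDerivAt_cyl_val` — **first variation** `(d/dt) g_t(v, w) = K_t(v, w) + K_t(w, v)` where
  `K_t` is the second fundamental form of `ι_t` w.r.t. `∂_t` (Bär–Hanke (8): `II_t = -½ ġ_t`
  with `II_t = -K_t`), an instance of `LevelFamilyVariation.lean` with `F = id`;
* `hasDerivAt_cyl_secondFundamentalForm_self` — **Riccati identity**
  `(d/dt) K_t(w, w) = G(R(∂_t, (w,0)) ∂_t, (w,0)) + G(D_w ∂_t, D_w ∂_t)` (BGM 2005, (4.?) /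
  O'Neill 1983, Ch. 8), from `hasDerivAt_secondFundamentalForm_self_family` and the geodesic
  property.

Everything is proved; no definitions, no named facts (D-0026).

## References

* C. Bär, P. Gauduchon, A. Moroianu, *Generalized cylinders in semi-Riemannian and spin
  geometry*, Math. Z. 249 (2005) 545–580, §2 and Prop. 4.1. [folklore]
* C. Bär, B. Hanke, *Boundary conditions for scalar curvature*, arXiv:2012.09127, §3, (8)–(9).
  [BarHanke2023]
* B. O'Neill, *Semi-Riemannian geometry* (1983), Ch. 4, Prop. 44; Ch. 7, Prop. 35. [ONeill1983]
-/

noncomputable section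

open Bundle Set Filter Function Metric
open scoped Manifold ContDiff Topology

namespace Literature.Geometry.Riemannian

open Literature.Geometry.Lorentzian
open Literature.Geometry.Lorentzian.PseudoRiemannianMetric

variable {E' : Type*} [NormedAddCommGroup E'] [NormedSpace ℝ E'] [FiniteDimensional ℝ E']
  {H' : Type*} [TopologicalSpace H'] {I' : ModelWithCorners ℝ E' H'} [I'.Boundaryless]
  {N : Type*} [TopologicalSpace N] [ChartedSpace H' N] [IsManifold I' ∞ N]

/-! ### Slices and `t`-lines of `N × ℝ` -/

section Slices

omit [FiniteDimensional ℝ E'] [I'.Boundaryless] [IsManifold I' ∞ N]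

/-- The slice inclusion `ι_t : y ↦ (y, t)` is `C^∞`. [folklore] -/
theorem contMDiff_cylSlice (t : ℝ) :
    ContMDiff I' (I'.prod 𝓘(ℝ, ℝ)) ∞ (fun y : N ↦ ((y, t) : N × ℝ)) :=
  contMDiff_id.prodMk contMDiff_const

/-- The `t`-line `τ ↦ (y, τ)` is `C^∞`. [folklore] -/
theorem contMDiff_cylLine (y : N) :
    ContMDiff 𝓘(ℝ, ℝ) (I'.prod 𝓘(ℝ, ℝ)) ∞ (fun τ : ℝ ↦ ((y, τ) : N × ℝ)) :=
  contMDiff_const.prodMk contMDiff_id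

/-- `dι_t(v) = (v, 0)` (`mfderiv_prod_left`). [folklore] -/
theorem mfderiv_cylSlice_apply (z : N) (t : ℝ) (v : E') :
    mfderiv I' (I'.prod 𝓘(ℝ, ℝ)) (fun y : N ↦ ((y, t) : N × ℝ)) z v =
      ((v, 0) : TangentSpace (I'.prod 𝓘(ℝ, ℝ)) (z, t)) := by
  rw [mfderiv_prod_left]; rfl

/-- `∂_t` of the `t`-line `τ ↦ (y, τ)` is `(0, 1)` (`mfderiv_prod_right`). [folklore] -/
theorem velocity_cylLine (y : N) (t : ℝ) :
    velocity (I'.prod 𝓘(ℝ, ℝ)) (fun τ : ℝ ↦ ((y, τ) : N × ℝ)) t =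
      (((0 : E'), (1 : ℝ)) : TangentSpace (I'.prod 𝓘(ℝ, ℝ)) (y, t)) := by
  show mfderiv 𝓘(ℝ, ℝ) (I'.prod 𝓘(ℝ, ℝ)) (fun τ : ℝ ↦ ((y, τ) : N × ℝ)) t 1 = _
  rw [mfderiv_prod_right]; rfl

/-- The identity family `F = id` of `N × ℝ` is `C^∞` near every point (the hypothesis `hF` of
`LevelFamilyVariation.lean`). [folklore] -/
theorem eventually_contMDiffAt_id_cyl (p : N × ℝ) :
    ∀ᶠ q in 𝓝 p, ContMDiffAt (I'.prod 𝓘(ℝ, ℝ)) (I'.prod 𝓘(ℝ, ℝ)) ∞ (fun q : N × ℝ ↦ q) q :=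
  Eventually.of_forall fun _ ↦ contMDiffAt_id

end Slices

/-! ### The cylinder property and its pointwise consequences -/

variable (G : PseudoRiemannianMetric (I'.prod 𝓘(ℝ, ℝ)) ∞ (E' × ℝ)
    (TangentSpace (I'.prod 𝓘(ℝ, ℝ)) : N × ℝ → Type _))

section Pointwise

omit [FiniteDimensional ℝ E'] [I'.Boundaryless]

/-- `G((0, 0), x) = 0` with the zero vector written as a pair (term-mode `map_zero`; explicit pairs
in tangent-space slots defeat `rw`). [folklore] -/
theorem cyl_val_mk_zero_left (p : N × ℝ) (x : TangentSpace (I'.prod 𝓘(ℝ, ℝ)) p) :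
    G.val p (((0 : E'), (0 : ℝ)) : TangentSpace (I'.prod 𝓘(ℝ, ℝ)) p) x = 0 := by
  have h : G.val p (0 : TangentSpace (I'.prod 𝓘(ℝ, ℝ)) p) = 0 := map_zero _
  exact DFunLike.congr_fun h x

/-- `G(∂_t, ∂_t) = 1`. [folklore] -/
theorem cyl_val_inr_inr
    (hcyl : ∀ (p : N × ℝ) (v w : TangentSpace (I'.prod 𝓘(ℝ, ℝ)) p),
      G.val p v w = G.val p ((v.1, 0) : TangentSpace (I'.prod 𝓘(ℝ, ℝ)) p)
        ((w.1, 0) : TangentSpace (I'.prod 𝓘(ℝ, ℝ)) p) + v.2 * w.2)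
    (p : N × ℝ) :
    G.val p (((0 : E'), (1 : ℝ)) : TangentSpace (I'.prod 𝓘(ℝ, ℝ)) p)
      (((0 : E'), (1 : ℝ)) : TangentSpace (I'.prod 𝓘(ℝ, ℝ)) p) = 1 := by
  have h := hcyl p (((0 : E'), (1 : ℝ)) : TangentSpace (I'.prod 𝓘(ℝ, ℝ)) p)
    (((0 : E'), (1 : ℝ)) : TangentSpace (I'.prod 𝓘(ℝ, ℝ)) p)
  have h0 := cyl_val_mk_zero_left G p (((0 : E'), (0 : ℝ)) : TangentSpace (I'.prod 𝓘(ℝ, ℝ)) p)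
  have h' : G.val p (((0 : E'), (1 : ℝ)) : TangentSpace (I'.prod 𝓘(ℝ, ℝ)) p)
      (((0 : E'), (1 : ℝ)) : TangentSpace (I'.prod 𝓘(ℝ, ℝ)) p) =
      G.val p (((0 : E'), (0 : ℝ)) : TangentSpace (I'.prod 𝓘(ℝ, ℝ)) p)
        (((0 : E'), (0 : ℝ)) : TangentSpace (I'.prod 𝓘(ℝ, ℝ)) p) + 1 * 1 := h
  linarith

/-- `G(∂_t, (u, 0)) = 0`: `∂_t` is normal to the slices. [folklore] -/
theorem cyl_val_inr_inl
    (hcyl : ∀ (p : N × ℝ) (v w : TangentSpace (I'.prod 𝓘(ℝ, ℝ)) p),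
      G.val p v w = G.val p ((v.1, 0) : TangentSpace (I'.prod 𝓘(ℝ, ℝ)) p)
        ((w.1, 0) : TangentSpace (I'.prod 𝓘(ℝ, ℝ)) p) + v.2 * w.2)
    (p : N × ℝ) (u : E') :
    G.val p (((0 : E'), (1 : ℝ)) : TangentSpace (I'.prod 𝓘(ℝ, ℝ)) p)
      ((u, (0 : ℝ)) : TangentSpace (I'.prod 𝓘(ℝ, ℝ)) p) = 0 := by
  have h := hcyl p (((0 : E'), (1 : ℝ)) : TangentSpace (I'.prod 𝓘(ℝ, ℝ)) p)
    ((u, (0 : ℝ)) : TangentSpace (I'.prod 𝓘(ℝ, ℝ)) p)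
  have h0 := cyl_val_mk_zero_left G p ((u, (0 : ℝ)) : TangentSpace (I'.prod 𝓘(ℝ, ℝ)) p)
  have h' : G.val p (((0 : E'), (1 : ℝ)) : TangentSpace (I'.prod 𝓘(ℝ, ℝ)) p)
      ((u, (0 : ℝ)) : TangentSpace (I'.prod 𝓘(ℝ, ℝ)) p) =
      G.val p (((0 : E'), (0 : ℝ)) : TangentSpace (I'.prod 𝓘(ℝ, ℝ)) p)
        ((u, (0 : ℝ)) : TangentSpace (I'.prod 𝓘(ℝ, ℝ)) p) + 1 * 0 := h
  linarith

/-- `G((u, 0), ∂_t) = 0`. [folklore] -/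
theorem cyl_val_inl_inr
    (hcyl : ∀ (p : N × ℝ) (v w : TangentSpace (I'.prod 𝓘(ℝ, ℝ)) p),
      G.val p v w = G.val p ((v.1, 0) : TangentSpace (I'.prod 𝓘(ℝ, ℝ)) p)
        ((w.1, 0) : TangentSpace (I'.prod 𝓘(ℝ, ℝ)) p) + v.2 * w.2)
    (p : N × ℝ) (u : E') :
    G.val p ((u, (0 : ℝ)) : TangentSpace (I'.prod 𝓘(ℝ, ℝ)) p)
      (((0 : E'), (1 : ℝ)) : TangentSpace (I'.prod 𝓘(ℝ, ℝ)) p) = 0 :=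
  (G.symm p _ _).trans (cyl_val_inr_inl G hcyl p u)

/-- A vector pairing to zero with `∂_t` and with all horizontal vectors vanishes (nondegeneracy;
`w = (w₁, 0) + w₂ • (0, 1)`). [folklore] -/
theorem cyl_eq_zero_of_val (p : N × ℝ) (D : TangentSpace (I'.prod 𝓘(ℝ, ℝ)) p)
    (h1 : G.val p D (((0 : E'), (1 : ℝ)) : TangentSpace (I'.prod 𝓘(ℝ, ℝ)) p) = 0)
    (h2 : ∀ u : E', G.val p D ((u, (0 : ℝ)) : TangentSpace (I'.prod 𝓘(ℝ, ℝ)) p) = 0) :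
    D = 0 := by
  refine G.nondegenerate p D fun w ↦ ?_
  obtain ⟨u, a⟩ := w
  have hw : ((u, a) : TangentSpace (I'.prod 𝓘(ℝ, ℝ)) p) =
      ((u, (0 : ℝ)) : TangentSpace (I'.prod 𝓘(ℝ, ℝ)) p) +
        a • (((0 : E'), (1 : ℝ)) : TangentSpace (I'.prod 𝓘(ℝ, ℝ)) p) :=
    Prod.ext (by simp) (by simp)
  have hlin : G.val p D ((u, a) : TangentSpace (I'.prod 𝓘(ℝ, ℝ)) p) =
      G.val p D ((u, (0 : ℝ)) : TangentSpace (I'.prod 𝓘(ℝ, ℝ)) p) +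
        a • G.val p D (((0 : E'), (1 : ℝ)) : TangentSpace (I'.prod 𝓘(ℝ, ℝ)) p) :=
    (congrArg (fun x ↦ G.val p D x) hw).trans
      ((map_add (G.val p D) _ _).trans (congrArg _ (map_smul (G.val p D) a _)))
  rw [h1, h2 u, smul_zero, add_zero] at hlin
  exact hlin

end Pointwise

/-! ### The `t`-lines are geodesics -/

variable [G.HasLeviCivita]

set_option maxHeartbeats 400000 in
/-- **The `t`-lines of a generalized cylinder are geodesics**: `D_t ∂_t = 0` along `τ ↦ (y, τ)`
(Bär–Gauduchon–Moroianu 2005, §2; O'Neill 1983, Ch. 7, Prop. 35 (1) for warped products).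
Proof by nondegeneracy of `G`: `G(D_t∂_t, ∂_t) = ½ ∂_t G(∂_t, ∂_t) = ½ ∂_t 1 = 0`; and for
`u ∈ T_yN`, with the two-parameter map `x(t, s) = (c_u(s), t)` (`∂_s x = (u, 0)` along `s = 0`),
`G(D_t∂_t, (u,0)) = ∂_t G(∂_t, ∂_s x) - G(∂_t, D_t∂_s x) = 0 - G(∂_t, D_s∂_t x) = -½ ∂_s G(∂_t,∂_t)
= 0` (metric compatibility `hasDerivAt_val_apply_along`, symmetry lemma
`covariantDerivAlong_velocity_comm`). [cite: ONeill1983, Ch. 7, Prop. 35] -/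
theorem covariantDerivAlong_velocity_cylLine
    (hcyl : ∀ (p : N × ℝ) (v w : TangentSpace (I'.prod 𝓘(ℝ, ℝ)) p),
      G.val p v w = G.val p ((v.1, 0) : TangentSpace (I'.prod 𝓘(ℝ, ℝ)) p)
        ((w.1, 0) : TangentSpace (I'.prod 𝓘(ℝ, ℝ)) p) + v.2 * w.2)
    (y : N) (t : ℝ) :
    covariantDerivAlong G.leviCivita (fun τ : ℝ ↦ ((y, τ) : N × ℝ))
      (fun τ ↦ velocity (I'.prod 𝓘(ℝ, ℝ)) (fun τ' : ℝ ↦ ((y, τ') : N × ℝ)) τ) t = 0 := by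
  set I2 := I'.prod 𝓘(ℝ, ℝ) with hI2
  set cov := G.leviCivita with hcov
  have hLC := isLeviCivita_leviCivita_holds (g := G)
  set γ : ℝ → N × ℝ := fun τ ↦ (y, τ) with hγ
  have hT : ∀ (y' : N) (τ : ℝ), (velocity I2 (fun τ' : ℝ ↦ ((y', τ') : N × ℝ)) τ : E' × ℝ) =
      ((0 : E'), (1 : ℝ)) := fun y' τ ↦ velocity_cylLine y' τ
  set D : TangentSpace I2 (γ t) := covariantDerivAlong cov γ (fun τ ↦ velocity I2 γ τ) t with hD
  -- Step 1: `G(D, ∂_t) = 0`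
  have hTlift : MDifferentiableAt 𝓘(ℝ, ℝ) I2.tangent
      (fun τ ↦ (TotalSpace.mk' (E' × ℝ) (γ τ) (velocity I2 γ τ) : TangentBundle I2 (N × ℝ))) t :=
    ((contMDiff_lift_velocity_of_contMDiff (contMDiff_cylLine y)) t).mdifferentiableAt (by simp)
  have h1 : G.val (γ t) D (((0 : E'), (1 : ℝ)) : TangentSpace I2 (γ t)) = 0 := by
    have h := G.hasDerivAt_val_apply_along hLC.2 hTlift hTlift
    have hconst : (fun τ ↦ G.val (γ τ) (velocity I2 γ τ) (velocity I2 γ τ)) = fun _ ↦ (1 : ℝ) := by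
      funext τ
      rw [hT y τ]
      exact cyl_val_inr_inr G hcyl (γ τ)
    rw [hconst] at h
    have h0 := (hasDerivAt_const t (1 : ℝ)).unique h
    rw [G.symm (γ t) (velocity I2 γ t), hT y t] at h0
    linarith
  -- Step 2: `G(D, (u, 0)) = 0`
  have h2 : ∀ u : E', G.val (γ t) D ((u, (0 : ℝ)) : TangentSpace I2 (γ t)) = 0 := by
    intro u
    set c : ℝ → N := curveThrough I' y u with hc
    set x : ℝ → ℝ → N × ℝ := fun τ s ↦ (c s, τ) with hx
    have hc0 : c 0 = y := curveThrough_zero I' y u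
    have hF := eventually_contMDiffAt_id_cyl (I' := I') ((y, t) : N × ℝ)
    have hx2 : ContMDiffAt (𝓘(ℝ, ℝ).prod 𝓘(ℝ, ℝ)) I2 2 (uncurry x) (t, 0) :=
      contMDiffAt_uncurry_family_curveThrough (I := I2) (F := fun q : N × ℝ ↦ q) hF u
    -- the variation field `S(τ) = ∂_s x(τ, 0) = (u, 0)`
    have hS : ∀ τ, (velocity I2 (fun s ↦ x τ s) 0 : E' × ℝ) = (u, (0 : ℝ)) := by
      intro τ
      have h := velocity_family_curveThrough (I := I2) (F := fun q : N × ℝ ↦ q) (z := y) (τ := τ)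
        (contMDiff_cylSlice (I' := I') τ y) u
      exact h.trans (mfderiv_cylSlice_apply y τ u)
    have hbase : (fun τ ↦ x τ 0) = γ := by
      funext τ
      exact congrArg (fun y' : N ↦ ((y', τ) : N × ℝ)) hc0
    have hSlift : MDifferentiableAt 𝓘(ℝ, ℝ) I2.tangent
        (fun τ ↦ (TotalSpace.mk' (E' × ℝ) (γ τ) (velocity I2 (fun s ↦ x τ s) 0 : E' × ℝ) :
          TangentBundle I2 (N × ℝ))) t :=
      mdifferentiableAt_lift_congr_base hbase (mdifferentiableAt_lift_velocity_curry_right hx2)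
    -- metric compatibility along `γ` for `∂_t` and `S`: the pairing is constantly `0`
    have hcompat := G.hasDerivAt_val_apply_along hLC.2 (γ := γ) (V := fun τ ↦ velocity I2 γ τ)
      (W := fun τ ↦ (velocity I2 (fun s ↦ x τ s) 0 : TangentSpace I2 (γ τ))) hTlift hSlift
    have hconst : (fun τ ↦ G.val (γ τ) (velocity I2 γ τ)
        (velocity I2 (fun s ↦ x τ s) 0 : TangentSpace I2 (γ τ))) = fun _ ↦ (0 : ℝ) := by
      funext τ
      rw [hT y τ, hS τ]
      exact cyl_val_inr_inl G hcyl (γ τ) u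
    rw [hconst] at hcompat
    have h0 := (hasDerivAt_const t (0 : ℝ)).unique hcompat
    -- `D_t S = D_s ∂_t` (symmetry lemma), transported to the base curve `γ`
    have hsymm : (covariantDerivAlong cov γ
        (fun τ ↦ (velocity I2 (fun s ↦ x τ s) 0 : TangentSpace I2 (γ τ))) t : E' × ℝ) =
          covariantDerivAlong cov (x t) (fun s ↦ velocity I2 (fun τ ↦ x τ s) t) 0 := by
      rw [← covariantDerivAlong_congr_base cov hbase (fun τ ↦ (velocity I2 (fun s ↦ x τ s) 0 :
        E' × ℝ)) t]
      exact covariantDerivAlong_velocity_comm cov hLC.1 hx2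
    -- `G(∂_t, D_s ∂_t) = ½ ∂_s G(∂_t, ∂_t) = 0` along the `s`-curve `s ↦ x t s`
    have hTs : MDifferentiableAt 𝓘(ℝ, ℝ) I2.tangent
        (fun s ↦ (TotalSpace.mk' (E' × ℝ) (x t s) (velocity I2 (fun τ ↦ x τ s) t) :
          TangentBundle I2 (N × ℝ))) 0 :=
      mdifferentiableAt_lift_velocity_curry_left hx2
    have h3 : G.val (x t 0) (covariantDerivAlong cov (x t) (fun s ↦ velocity I2 (fun τ ↦ x τ s) t) 0)
        (velocity I2 (fun τ ↦ x τ 0) t) = 0 := by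
      have h := G.hasDerivAt_val_apply_along hLC.2 hTs hTs
      have hconst' : (fun s ↦ G.val (x t s) (velocity I2 (fun τ ↦ x τ s) t)
          (velocity I2 (fun τ ↦ x τ s) t)) = fun _ ↦ (1 : ℝ) := by
        funext s
        rw [hT (c s) t]
        exact cyl_val_inr_inr G hcyl (x t s)
      rw [hconst'] at h
      have h0' := (hasDerivAt_const (0 : ℝ) (1 : ℝ)).unique h
      rw [G.symm (x t 0) (velocity I2 (fun τ ↦ x τ 0) t)] at h0'
      linarith
    -- the second summand of `h0` vanishes
    have hp : x t 0 = γ t := congrFun hbase t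
    have hsecond : G.val (γ t) (velocity I2 γ t) (covariantDerivAlong cov γ
        (fun τ ↦ (velocity I2 (fun s ↦ x τ s) 0 : TangentSpace I2 (γ τ))) t) = 0 := by
      rw [hT y t, ← val_congr_point (g := G) hp]
      show G.val (x t 0) (((0 : E'), (1 : ℝ)) : TangentSpace I2 (x t 0))
        (covariantDerivAlong cov γ
          (fun τ ↦ (velocity I2 (fun s ↦ x τ s) 0 : TangentSpace I2 (γ τ))) t : E' × ℝ) = 0
      rw [hsymm, ← hT (c 0) t, G.symm]
      exact h3
    rw [hsecond, add_zero, hS t] at h0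
    exact h0.symm
  exact cyl_eq_zero_of_val G (γ t) D h1 h2

/-! ### First variation and the Riccati identity on a cylinder -/

/-- **`ġ_t(v, w) = K_t(v, w) + K_t(w, v)`** on a cylinder (Bär–Hanke 2023, §3, (8); no cylinder
property needed): for `v, w ∈ T_zN`, `τ ↦ G_{(z,τ)}((v,0), (w,0)) = g_τ(v, w)` has derivative
`K_t(v, w) + K_t(w, v)` at `t`, where `K_t` is the second fundamental form of the slice `ι_t` with
respect to the field `∂_t` along it (`hasDerivAt_val_mfderiv_family_eq_secondFundamentalForm` with
`F = id`, `dι_τ v = (v, 0)`). [cite: BarHanke2023, §3, (8)] -/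
theorem hasDerivAt_cyl_val (z : N) (t : ℝ) (v w : E') :
    HasDerivAt (fun τ ↦ G.val (z, τ) ((v, 0) : TangentSpace (I'.prod 𝓘(ℝ, ℝ)) (z, τ))
        ((w, 0) : TangentSpace (I'.prod 𝓘(ℝ, ℝ)) (z, τ)))
      (G.secondFundamentalForm I' (fun y : N ↦ ((y, t) : N × ℝ))
          (fun y ↦ velocity (I'.prod 𝓘(ℝ, ℝ)) (fun s : ℝ ↦ ((y, s) : N × ℝ)) t) z v w +
        G.secondFundamentalForm I' (fun y : N ↦ ((y, t) : N × ℝ))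
          (fun y ↦ velocity (I'.prod 𝓘(ℝ, ℝ)) (fun s : ℝ ↦ ((y, s) : N × ℝ)) t) z w v) t := by
  have h : HasDerivAt (fun τ ↦ G.val (z, τ)
      (mfderiv I' (I'.prod 𝓘(ℝ, ℝ)) (fun y : N ↦ ((y, τ) : N × ℝ)) z v)
      (mfderiv I' (I'.prod 𝓘(ℝ, ℝ)) (fun y : N ↦ ((y, τ) : N × ℝ)) z w))
      (G.secondFundamentalForm I' (fun y : N ↦ ((y, t) : N × ℝ))
          (fun y ↦ velocity (I'.prod 𝓘(ℝ, ℝ)) (fun s : ℝ ↦ ((y, s) : N × ℝ)) t) z v w +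
        G.secondFundamentalForm I' (fun y : N ↦ ((y, t) : N × ℝ))
          (fun y ↦ velocity (I'.prod 𝓘(ℝ, ℝ)) (fun s : ℝ ↦ ((y, s) : N × ℝ)) t) z w v) t :=
    hasDerivAt_val_mfderiv_family_eq_secondFundamentalForm (I := I'.prod 𝓘(ℝ, ℝ)) G
      (F := fun q : N × ℝ ↦ q) (eventually_contMDiffAt_id_cyl (I' := I') ((z, t) : N × ℝ)) v w
  refine h.congr_of_eventuallyEq (Eventually.of_forall fun τ ↦ ?_)
  show G.val (z, τ) ((v, 0) : TangentSpace (I'.prod 𝓘(ℝ, ℝ)) (z, τ))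
      ((w, 0) : TangentSpace (I'.prod 𝓘(ℝ, ℝ)) (z, τ)) =
    G.val (z, τ) (mfderiv I' (I'.prod 𝓘(ℝ, ℝ)) (fun y : N ↦ ((y, τ) : N × ℝ)) z v)
      (mfderiv I' (I'.prod 𝓘(ℝ, ℝ)) (fun y : N ↦ ((y, τ) : N × ℝ)) z w)
  rw [mfderiv_cylSlice_apply, mfderiv_cylSlice_apply]

/-- **The Riccati identity for the second fundamental forms of the slices of a generalized
cylinder** (Bär–Gauduchon–Moroianu 2005, §4; O'Neill 1983, Ch. 8): for `w ∈ T_zN`,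
`τ ↦ K_τ(w, w)` has derivative `G(R(∂_t, (w,0)) ∂_t, (w,0)) + G(D_w ∂_t, D_w ∂_t)` at `t`
(`hasDerivAt_secondFundamentalForm_self_family` with `F = id`; the `t`-lines are geodesics by
`covariantDerivAlong_velocity_cylLine`; the Levi-Civita connection of the `C^∞` metric `G` is
locally `C¹`, `isLocallyContMDiff_leviCivita_holds`). [cite: BarHanke2023, §3, (9)] -/
theorem hasDerivAt_cyl_secondFundamentalForm_self
    (hcyl : ∀ (p : N × ℝ) (v w : TangentSpace (I'.prod 𝓘(ℝ, ℝ)) p),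
      G.val p v w = G.val p ((v.1, 0) : TangentSpace (I'.prod 𝓘(ℝ, ℝ)) p)
        ((w.1, 0) : TangentSpace (I'.prod 𝓘(ℝ, ℝ)) p) + v.2 * w.2)
    (z : N) (t : ℝ) (w : E') :
    HasDerivAt (fun τ ↦ G.secondFundamentalForm I' (fun y : N ↦ ((y, τ) : N × ℝ))
        (fun y ↦ velocity (I'.prod 𝓘(ℝ, ℝ)) (fun s : ℝ ↦ ((y, s) : N × ℝ)) τ) z w w)
      (G.val (z, t)
          (G.leviCivita.curvature (z, t) (((0 : E'), (1 : ℝ)) : TangentSpace (I'.prod 𝓘(ℝ, ℝ)) (z, t))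
            ((w, 0) : TangentSpace (I'.prod 𝓘(ℝ, ℝ)) (z, t))
            (((0 : E'), (1 : ℝ)) : TangentSpace (I'.prod 𝓘(ℝ, ℝ)) (z, t)))
          ((w, 0) : TangentSpace (I'.prod 𝓘(ℝ, ℝ)) (z, t)) +
        G.val (z, t)
          (G.normalDerivAlong (I' := I') (fun y : N ↦ ((y, t) : N × ℝ))
            (fun y ↦ velocity (I'.prod 𝓘(ℝ, ℝ)) (fun s : ℝ ↦ ((y, s) : N × ℝ)) t) z w)
          (G.normalDerivAlong (I' := I') (fun y : N ↦ ((y, t) : N × ℝ))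
            (fun y ↦ velocity (I'.prod 𝓘(ℝ, ℝ)) (fun s : ℝ ↦ ((y, s) : N × ℝ)) t) z w)) t := by
  have hcov₁ : G.leviCivita.IsLocallyContMDiff 1 :=
    G.isLocallyContMDiff_leviCivita_holds 1 (by exact WithTop.coe_le_coe.2 le_top)
  have hgeo : ∀ᶠ y in 𝓝 z, covariantDerivAlong G.leviCivita (fun τ ↦ (fun q : N × ℝ ↦ q) (y, τ))
      (fun τ ↦ velocity (I'.prod 𝓘(ℝ, ℝ)) (fun τ' : ℝ ↦ (fun q : N × ℝ ↦ q) (y, τ')) τ) t = 0 :=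
    Eventually.of_forall fun y ↦ covariantDerivAlong_velocity_cylLine G hcyl y t
  have h := hasDerivAt_secondFundamentalForm_self_family (I := I'.prod 𝓘(ℝ, ℝ)) G hcov₁
    (F := fun q : N × ℝ ↦ q) (eventually_contMDiffAt_id_cyl (I' := I') ((z, t) : N × ℝ)) hgeo w
  refine h.congr_deriv ?_
  show G.val (z, t) (G.leviCivita.curvature (z, t)
      (velocity (I'.prod 𝓘(ℝ, ℝ)) (fun τ' : ℝ ↦ ((z, τ') : N × ℝ)) t)
      (mfderiv I' (I'.prod 𝓘(ℝ, ℝ)) (fun y : N ↦ ((y, t) : N × ℝ)) z w)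
      (velocity (I'.prod 𝓘(ℝ, ℝ)) (fun τ' : ℝ ↦ ((z, τ') : N × ℝ)) t))
      (mfderiv I' (I'.prod 𝓘(ℝ, ℝ)) (fun y : N ↦ ((y, t) : N × ℝ)) z w) + _ = _
  rw [velocity_cylLine, mfderiv_cylSlice_apply]

end Literature.Geometry.Riemannian
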